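import Summits.QuantumFields.BalabanUV.T4Continuum.Spine.NE7.QLaCriticality

/-!
# Spine/NE7/QLaHolonomyDefect — NODE S re-based on a GAUGE-INVARIANT HOLONOMY-LEVEL shape: the second-order loop defect
# needs only «the closed-walk holonomy of the averaged configuration is within `Ch·|w|·θⁿ·tv(1,V)` of the identity»,
# which is WEAKER than NE1a-STEP and is the column-sum reading of the PRINTED per-entry Jacobian bound of the composed
# averaging ([Balaban1985Averaging] Prop. 5 (156) with (138))

Cell `pub-balaban-gaps` (YM blitz Y1, track G2, seat `ne7`, generation 4); text of record
`run/shared/lean/pub/pub-balaban-gaps/ne/NE7.md` v4 §4quinquies, census rows R32–R40.  Eighth `Spine/NE7/` file (after `Targets`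
p339119, `QLa` p339533, `QLaBudget` p340302, `QLaFromNE1p` p340630, `QLaCriticality` p342645, `QLaCriticalityAxial` p343210,
`QLaSchurChannel` p343076).

WHY.  Generation 3 closed NE7's last located IDEA-risk sub-claim at `U = 1` by CRITICALITY (`QLaCriticality`:
`1 − Re tr U/N ≤ ½‖U − 1‖²_op` on `U(N)`, PROVED) composed with the tree's tower bookkeeping `T4AvgDerivBound.descend`, whose
input is the ONE-STEP hypothesis shape `AvgStepContraction av dom θ` = NE1a-STEP («one averaging step contracts the total
variation of a configuration change by `θ` modulo a coarse gauge transformation») — a statement that is NOT PRINTED as typed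
and that the `pub-balaban` cell's DAG (T4-DAG v7) took OFF its critical path: NE1a's rate `θ₁ = L^{1−d}` is read there as
PRINTED PER JACOBIAN ENTRY — [Balaban1985Averaging] Prop. 5 p. 42, (156) «|(δ/δA_b) Q_k(U₀, ηA, c)| ≤ 1 + 2C′₁α₀ + C₃|A|»,
normalised by (138) p. 39 («the functional derivative coincides with partial derivatives (gradient) of F(A) multiplied by
η^{−d}»), i.e. `‖∂Q_k(U₀, a, c)/∂a_b‖ ≤ L^{(1−d)k}(1 + 2C′₁α₀ + C₃α₁)` per entry on the (158)-box domains (row O3c.E3*,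
record `t4/T4-EST-O3cNE1a.md`, kernel companions `T4AvgJacobianL1` ∕ `T4AvgDerivBound` v1.3; adversarial cross-read
C-pv12g6-3 CONCURS) — for DERIVATIVE ∕ one-bond consumers.  THIS FILE shows that NODE S is such a consumer: what criticality
needs is NOT the total-variation contraction of the whole coarse configuration but only a bound on the invariant distance of
the CLOSED-WALK HOLONOMY of `avgⁿ V` to the identity — the shape `HolDevBound av dom Ch θ` of §1,
`dist1 (𝒰_w(avgⁿ V)) ≤ Ch · |w| · tv(1, V) · θⁿ`, which (i) is GAUGE INVARIANT as stated (`dist1` is conjugation invariant,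
§1), (ii) FOLLOWS from NE1a-STEP (§2, the factorisation of generation 3's proof: `Ch = 1`) and from the per-coarse-bond form
`BondDevBound` in which a per-entry Jacobian bound arrives (§1b, `holDevBound_of_bondDevBound`), (iii) is, on a box domain
star-shaped about the flat configuration, the per-entry bound (156) integrated along the segment `s ↦ sV` and summed over the
`|w|` bonds of the walk — a COLUMN SUM of the printed Jacobian bound — and (156) itself is a KERNEL THEOREM of the tree's B7 fold for its model
`logCovIter` of the averaging (15) on `ℤ^d` with corner blocks: `B7Prop5Cplx.prop5_cplx_156_printed` (complex background `U′U₀`;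
`B7Prop5General.prop5_general_156_printed` at `U′ = 1`; `B7Prop5Flat.prop5_flat_156` at the FLAT background `U₀ = 1`, `α₀ = 0` —
NODE S's own case; cell `lit-balaban`, seats p06∕r04) — so what separates NODE S from a
kernel input here is BOOKKEEPING only: the segment∕column-sum step (record `t4/T4-EST-O3cNE1a.md` §3 (S1)–(S5)) and the bridge from
the B7 fold's `ℤ^d`∕corner-block objects to the torus `Setup.Averaging` vocabulary of this file (DIVERGENCES F3∕F6), chartered by the
`pub-balaban-gaps` lead to seat g2-p6 ([LEAD-G5-OPS-G2SEATS] 2026-08-22T23:42Z; interface = `BondDevBound` of §1b); NOT done here —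
and (iv) is PROVED OUTRIGHT with
`θ = L^{1−d}`, `Ch = 1`, all configurations, in the abelian block model of the companion file `QLaAbelianBlockModel` (generation 4,
file 9).  §3: criticality + `HolDevBound` ⟹ generation 3's `LoopDefectBound av dom (Cc·Ch²) θ`, after which `loopDefect_le_of_support`
∕ `qlaPt_of_defect` ∕ `qla_of_defect` (p342645) apply verbatim: NODE S = (QL-a)∣_{U=1} ⇐ {criticality (PROVED), `HolDevBound`
((156)-KIND), (W-fmt@1) (NODE O), the (0.26) census}.

HONEST FRAMING.  [folklore] bookkeeping over the tree's abstract `GaugeGroup` ∕ `Averaging` vocabulary; `HolDevBound` is a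
HYPOTHESIS SHAPE consumed as a hypothesis; nothing of Bałaban's averaging (15), of its (158)-box domains, or of the (1.100)
insert of [Balaban1989LargeFieldI] p. 201 is asserted.  (QL-a) NOT IN PRINT ([Balaban1989LargeFieldII] p. 356 defers
observables); NE7 NOT proved; spine 0∕9; fixed finite T⁴ — NOT ℝ⁴, NOT infinite volume, NOT a mass gap, NOT Clay.  Census
effect (NE7.md v4): NODE S's one located-unprinted input NE1a-STEP is replaced by the weaker holonomy-level shape whose
printed source (156) is PROVED in the tree's B7 fold (bridge bookkeeping pending, seat g2-p6); NE7-own residue unchanged = WORK (NODE O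
functional half, S0).
-/

noncomputable section

open Finset
open scoped BigOperators

namespace Summit.QuantumFields.BalabanUV.T4Continuum.Spine.NE7

open Literature.MathematicalPhysics.QuantumFieldTheory.Balaban1983to89
open Literature.MathematicalPhysics.QuantumFieldTheory.Balaban1983to89.T4Continuum
open Literature.MathematicalPhysics.QuantumFieldTheory.Balaban1983to89.T4AvgSensitivity
open Literature.MathematicalPhysics.QuantumFieldTheory.Balaban1983to89.T4AvgDerivBound

variable {P : Params} {G : Type*} [GaugeGroup G]

/-! ## §1 The holonomy-deviation shape and its gauge invariance -/

/-- [shape] HYPOTHESIS SHAPE — THE HOLONOMY DEVIATION BOUND (cell typing, generation 4; consumed only as a hypothesis): for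
all levels `k`, all `n` with `k + n ≤ m + K`, every closed walk `(x, w)` at level `k + n` and every domain configuration `V` of
level `k` (the trivial one being in the domain), the invariant distance of the holonomy of the `n`-fold average of `V` along the
walk to the identity is at most `Ch · |w| · tv(1, V) · θⁿ`.  GAUGE INVARIANT as stated (`dist1_holAt_gaugeAct_walk`).  Implied by
NE1a-STEP (`holDevBound_of_stepContraction`, `Ch = 1`); it is the COLUMN-SUM form of the printed per-entry Jacobian bound of the
composed averaging, [Balaban1985Averaging] Prop. 5 (156) p. 42 read with (138) p. 39 (rate `L^{1−d}` per level and entry on the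
(158)-box domains — the `pub-balaban` cell's reading of NE1a, row O3c.E3*; (156) is PROVED in the tree's B7 fold for its `ℤ^d` model
of (15): `B7Prop5Cplx.prop5_cplx_156_printed`), summed over the `|w|` bonds of the walk (via `BondDevBound`, §1b); proved outright in
the abelian block model (`QLaAbelianBlockContraction.holDevBound_linAvg`).  (Cell typing, NOT a printed statement: tagged folklore;
the printed input it abstracts is cited in prose.) [folklore] -/
def HolDevBound (av : ∀ j, Averaging P j G) (dom : ∀ j, Set (GaugeField P j G)) (Ch θ : ℝ) : Prop :=
  ∀ (k n : ℕ), k + n ≤ P.m + P.K → ∀ (x : Site P (k + n)) (w : List (Letter P.d)), walkEnd x w = x →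
    ∀ V : GaugeField P k G, V ∈ dom k → (1 : GaugeField P k G) ∈ dom k →
      dist1 (holAt (iterFrom av k n V) (walk x w)) ≤ Ch * ((w.length : ℝ) * tv 1 V * θ ^ n)

/-- The invariant distance of a CLOSED-walk holonomy to the identity is gauge invariant ([Balaban1985Averaging] (8) telescoped,
`holAt_gaugeAct_walk`, and conjugation invariance of `dist1`). [folklore] -/
theorem dist1_holAt_gaugeAct_walk {j : ℕ} (u : GaugeTransf P j G) (U : GaugeField P j G) (x : Site P j)
    (w : List (Letter P.d)) (hw : walkEnd x w = x) :
    dist1 (holAt (GaugeField.gaugeAct u U) (walk x w)) = dist1 (holAt U (walk x w)) := by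
  rw [holAt_gaugeAct_walk, hw, GaugeGroup.dist1_conj]

/-- `HolDevBound` is monotone in its constant. [folklore] -/
theorem HolDevBound.mono {av : ∀ j, Averaging P j G} {dom : ∀ j, Set (GaugeField P j G)} {Ch Ch' θ : ℝ}
    (h : HolDevBound av dom Ch θ) (hC : Ch ≤ Ch') (hθ : 0 ≤ θ) : HolDevBound av dom Ch' θ := by
  intro k n hn x w hw V hV h1
  refine (h k n hn x w hw V hV h1).trans (mul_le_mul_of_nonneg_right hC ?_)
  exact mul_nonneg (mul_nonneg (Nat.cast_nonneg _) (tv_nonneg _ _)) (pow_nonneg hθ n)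

/-- `HolDevBound` is antitone in the domain family. [folklore] -/
theorem HolDevBound.anti {av : ∀ j, Averaging P j G} {dom dom' : ∀ j, Set (GaugeField P j G)} {Ch θ : ℝ}
    (h : HolDevBound av dom Ch θ) (hdom : ∀ j, dom' j ⊆ dom j) : HolDevBound av dom' Ch θ :=
  fun k n hn x w hw V hV h1 => h k n hn x w hw V (hdom k hV) (hdom k h1)

/-! ## §1b The per-coarse-bond form: the shape the printed per-entry Jacobian bound delivers, and its passage to `HolDevBound` -/

/-- [shape] HYPOTHESIS SHAPE — THE PER-COARSE-BOND DEVIATION BOUND MODULO GAUGE (cell typing, generation 4; consumed only as a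
hypothesis): for every domain configuration `V` of level `k` there is a gauge transformation `u` of level `k + n` in which EVERY
coarse bond variable of `avgⁿ V` is within `Cb · tv(1, V) · θⁿ` of the identity.  This is the form in which the printed per-entry
Jacobian bound arrives: [Balaban1985Averaging] Prop. 5 (156) p. 42 with (138) p. 39 bounds, in the printed frame gauge
(159)–(160) p. 42, the derivative of each coarse bond angle of the composed averaging by `L^{(1−d)n}(1 + 2C′₁α₀ + C₃α₁)` per fine
bond angle on the (158)-box domains; integrating along `s ↦ sV` inside the box and summing over the fine bonds gives this shape with
`θ = L^{1−d}` (the `pub-balaban` record `t4/T4-EST-O3cNE1a.md` §3 (S1)–(S5) is exactly this bookkeeping for a one-bond change).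
The per-entry bound itself is a KERNEL THEOREM of the tree's B7 fold for its `ℤ^d`∕corner-block model `logCovIter` of (15)
(`B7Prop5Cplx.prop5_cplx_156_printed`, `B7Prop5General.prop5_general_156_printed`; at the flat background `B7Prop5Flat.prop5_flat_156`);
deriving THIS shape from it for a torus
`Setup.Averaging` realising (15) is bookkeeping + the `ℤ^d`↔torus ∕ corner↔centre bridge (DIVERGENCES F3∕F6) — the charter of seat
g2-p6 of `pub-balaban-gaps`; NOT done here. [folklore] -/
def BondDevBound (av : ∀ j, Averaging P j G) (dom : ∀ j, Set (GaugeField P j G)) (Cb θ : ℝ) : Prop :=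
  ∀ (k n : ℕ), k + n ≤ P.m + P.K → ∀ V : GaugeField P k G, V ∈ dom k → (1 : GaugeField P k G) ∈ dom k →
    ∃ u : GaugeTransf P (k + n) G, ∀ c : PBond P (k + n),
      bdist ((1 : GaugeField P (k + n) G) c) (GaugeField.gaugeAct u (iterFrom av k n V) c) ≤ Cb * (tv 1 V * θ ^ n)

/-- **`BondDevBound` ⟹ `HolDevBound`** (kernel bookkeeping, same constant): the closed-walk holonomy does not see the gauge
transformation (§1), and along the walk the holonomy deviates from the identity by at most the sum of the `|w|` bond deviations
(`holAt_bdist_le`, tree).  So the per-entry∕column reading of (156) feeds NODE S through this lemma. [folklore] -/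
theorem holDevBound_of_bondDevBound {av : ∀ j, Averaging P j G} {dom : ∀ j, Set (GaugeField P j G)} {Cb θ : ℝ}
    (h : BondDevBound av dom Cb θ) : HolDevBound av dom Cb θ := by
  intro k n hn x w hw V hV h1
  obtain ⟨u, hu⟩ := h k n hn V hV h1
  rw [← dist1_holAt_gaugeAct_walk u (iterFrom av k n V) x w hw, dist1_holAt_eq_bdist]
  refine (holAt_bdist_le 1 _ (walk x w)).trans ?_
  have hsum := List.sum_le_card_nsmul
    ((walk x w).map fun s => bdist ((1 : GaugeField P (k + n) G) s.bond)
      (GaugeField.gaugeAct u (iterFrom av k n V) s.bond)) (Cb * (tv 1 V * θ ^ n)) (by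
    intro y hy
    obtain ⟨s, _, rfl⟩ := List.mem_map.mp hy
    exact hu s.bond)
  refine hsum.trans (le_of_eq ?_)
  rw [List.length_map, length_walk, nsmul_eq_mul]
  ring

/-! ## §2 NE1a-STEP implies the holonomy deviation bound (the factorisation of generation 3's proof) -/

/-- **NE1a-STEP ⟹ `HolDevBound` with `Ch = 1`** (kernel bookkeeping): if the domains propagate and are gauge stable, ONE
averaging step contracts total variation modulo a coarse gauge transformation by `θ` (`AvgStepContraction`, NE1a-STEP — consumed
BY NAME) and averaging fixes the trivial configuration (`AvgFlat`), then `dist1 (𝒰_w(avgⁿ V)) ≤ |w| · tv(1,V) · θⁿ`.  Proof: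
`descend` (tree) puts `avgⁿ V` within total variation `θⁿ · tv(1, V)` of `avgⁿ 1 = 1` modulo a gauge transformation, which the
closed walk does not see (§1); the holonomy along the walk is then within `|w| · θⁿ · tv(1, V)` of the identity
(`holAt_bdist_le_length_mul_tv`, tree).  So the new shape is WEAKER than NE1a-STEP. [folklore] -/
theorem holDevBound_of_stepContraction {av : ∀ j, Averaging P j G} {dom : ∀ j, Set (GaugeField P j G)} {θ : ℝ}
    (hdom : DomStable av dom) (hg : GaugeStable dom) (hstep : AvgStepContraction av dom θ) (hθ : 0 ≤ θ)
    (hflat : AvgFlat av) : HolDevBound av dom 1 θ := by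
  intro k n hn x w hw V hV h1
  obtain ⟨Y, u, _, hEq, hTV⟩ := descend hdom hg hstep hθ n hn 1 V h1 hV
  rw [hEq, dist1_holAt_gaugeAct_walk u Y x w hw, one_mul, dist1_holAt_eq_bdist]
  rw [iterFrom_one hflat n hn] at hTV
  refine (holAt_bdist_le_length_mul_tv 1 Y (walk x w)).trans ?_
  rw [length_walk]
  have hw0 : (0 : ℝ) ≤ (w.length : ℝ) := Nat.cast_nonneg _
  calc (w.length : ℝ) * tv 1 Y ≤ (w.length : ℝ) * (θ ^ n * tv 1 V) := mul_le_mul_of_nonneg_left hTV hw0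
    _ = (w.length : ℝ) * tv 1 V * θ ^ n := by ring

/-! ## §3 Criticality squares the holonomy deviation: `HolDevBound` ⟹ the second-order `LoopDefectBound` -/

/-- **CRITICALITY + `HolDevBound` ⟹ `LoopDefectBound`** (kernel bookkeeping): if `reTr` is critical at the identity
(`ReTrCrit G Cc`: `1 − reTr g ≤ Cc · (dist1 g)²` — PROVED with `Cc = ½` for `U(n)`, `SU(n)` in `QLaCriticality`) and the
closed-walk holonomies of averaged configurations obey `HolDevBound av dom Ch θ`, then
`0 ≤ 1 − W(avgⁿ V) ≤ Cc·Ch² · (|w| · tv(1,V) · θⁿ)²` — generation 3's `LoopDefectBound av dom (Cc·Ch²) θ`, whence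
`loopDefect_le_of_support` (rate `θ²` per level, polynomial weight) and `qla_of_defect` (`QLa` with `a = θ²Λ`) apply verbatim.
No property of any measure, no expansion in the fluctuation, and — compared with `loopDefectBound_of_stepContraction` — no
total-variation contraction of the coarse CONFIGURATION: only the holonomy along the loop is asked to be close to `1`. [folklore] -/
theorem loopDefectBound_of_holDevBound {av : ∀ j, Averaging P j G} {dom : ∀ j, Set (GaugeField P j G)} {Cc Ch θ : ℝ}
    (hcrit : ReTrCrit G Cc) (hCc : 0 ≤ Cc) (hhol : HolDevBound av dom Ch θ) :
    LoopDefectBound av dom (Cc * Ch ^ 2) θ := by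
  intro k n hn x w hw V hV h1
  have hdist := hhol k n hn x w hw V hV h1
  have hsq : dist1 (holAt (iterFrom av k n V) (walk x w)) ^ 2 ≤ (Ch * ((w.length : ℝ) * tv 1 V * θ ^ n)) ^ 2 :=
    pow_le_pow_left₀ (GaugeGroup.dist1_nonneg _) hdist 2
  rw [loopAt]
  refine (hcrit _).trans ?_
  calc Cc * dist1 (holAt (iterFrom av k n V) (walk x w)) ^ 2 ≤ Cc * (Ch * ((w.length : ℝ) * tv 1 V * θ ^ n)) ^ 2 :=
        mul_le_mul_of_nonneg_left hsq hCc
    _ = Cc * Ch ^ 2 * ((w.length : ℝ) * tv 1 V * θ ^ n) ^ 2 := by ring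

/-- RECOVERY of generation 3's theorem through the new interface: NE1a-STEP ⟹ `HolDevBound` (§2) ⟹ `LoopDefectBound av dom Cc θ`
(§3 with `Ch = 1`) — `loopDefectBound_of_stepContraction` (p342645) is the composite. [folklore] -/
theorem loopDefectBound_of_stepContraction' {av : ∀ j, Averaging P j G} {dom : ∀ j, Set (GaugeField P j G)} {Cc θ : ℝ}
    (hcrit : ReTrCrit G Cc) (hCc : 0 ≤ Cc) (hdom : DomStable av dom) (hg : GaugeStable dom)
    (hstep : AvgStepContraction av dom θ) (hθ : 0 ≤ θ) (hflat : AvgFlat av) : LoopDefectBound av dom Cc θ := by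
  have h := loopDefectBound_of_holDevBound hcrit hCc (holDevBound_of_stepContraction hdom hg hstep hθ hflat)
  simpa only [one_pow, mul_one] using h

/-- THE HOLONOMY FORM WITH THE SUPPORT MADE EXPLICIT: a configuration trivial off a finite set `Λ` of level-`k` bonds with
one-bond deviations at most `D` has, under `HolDevBound`, closed-walk holonomies within `Ch·|w|·|Λ|·D·θⁿ` of the identity —
FIRST order in `θ` at the holonomy level; the loop VARIABLE's defect is its square (§3), the SECOND-order currency of row NE1′.
[folklore] -/
theorem holDev_le_of_support {av : ∀ j, Averaging P j G} {dom : ∀ j, Set (GaugeField P j G)} {Ch θ : ℝ}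
    (h : HolDevBound av dom Ch θ) (hCh : 0 ≤ Ch) (hθ : 0 ≤ θ) {k n : ℕ} (hn : k + n ≤ P.m + P.K)
    (x : Site P (k + n)) (w : List (Letter P.d)) (hw : walkEnd x w = x) (V : GaugeField P k G) (hV : V ∈ dom k)
    (h1 : (1 : GaugeField P k G) ∈ dom k) (Λ : Finset (PBond P k)) (hoff : ∀ b, b ∉ Λ → V b = 1) {D : ℝ}
    (hD : ∀ b ∈ Λ, dist1 (V b) ≤ D) :
    dist1 (holAt (iterFrom av k n V) (walk x w)) ≤ Ch * ((w.length : ℝ) * (Λ.card * D) * θ ^ n) := by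
  have htv : tv (1 : GaugeField P k G) V ≤ Λ.card * D := by
    rw [tv_eq_sum_of_agreeOff Λ 1 V fun b hb => (hoff b hb).symm]
    calc ∑ b ∈ Λ, bdist ((1 : GaugeField P k G) b) (V b) = ∑ b ∈ Λ, dist1 (V b) :=
          Finset.sum_congr rfl fun b _ => by rw [bdist_def, show (1 : GaugeField P k G) b = 1 from rfl, inv_one, one_mul]
      _ ≤ ∑ _b ∈ Λ, D := Finset.sum_le_sum fun b hb => hD b hb
      _ = Λ.card * D := by rw [Finset.sum_const, nsmul_eq_mul]
  refine (h k n hn x w hw V hV h1).trans (mul_le_mul_of_nonneg_left ?_ hCh)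
  have hw0 : (0 : ℝ) ≤ (w.length : ℝ) := Nat.cast_nonneg _
  exact mul_le_mul_of_nonneg_right (mul_le_mul_of_nonneg_left htv hw0) (pow_nonneg hθ n)

end Summit.QuantumFields.BalabanUV.T4Continuum.Spine.NE7

end
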